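import Summits.PneNP.PneNP.Theorems.ReslinMediumCoverExpanderFamily
import Summits.PneNP.PneNP.Theorems.ReslinMediumCoverManyMediumLinesRankBound
import Summits.PneNP.PneNP.Theorems.ReslinMediumCoverTseitinMajParams
import Summits.PneNP.PneNP.Theorems.ReslinMediumCoverTseitinMajUnsat
import Summits.PneNP.PneNP.Theorems.ReslinSizeFromWidthTreeLike
import Summits.PneNP.PneNP.Theorems.ReslinSizeFromWidthQuadratic

/-!
# PneNP / ReslinMediumCover — an UNCONDITIONAL hard family for Res(⊕) rank, tree-like size and
# quadratic dag-like size: `τ(G_N, c) ∘ MAJ₃` over the expanders of `ExpanderFamily`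

Route `PneNP/ReslinMediumCover` (draft; crux `ManyMediumLines` = stmt-PneNP-19698, open, NOT claimed).
With the expander family now in the tree (`exists_medium_edgeExpander`: `N ≥ 2^18`, degree `≤ 514`,
`≥ 2N` boundary edges on every medium set) the lifted Tseitin contradictions
`φ_N := tseitinMaj G_N c₀` (`c₀` = vertex `0` charged) form an explicit-size family of UNSATISFIABLE
CNFs of width `≤ 1542` with `≤ 8^514 · N` clauses (variable indices `< 3N²`) such that EVERY Res(⊕)
refutation `π` (Itsykson–Sokolov's system, semantic weakening):
* has a line of rank `> 2N` (`resLinWidth π > 2N`; the boundary law of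
  `…ManyMediumLinesBoundaryLaw` / `…RankBound`, rung 5 — a second proof, for `MAJ₃`, of the width
  lifting theorem of Alekseev–Itsykson STOC 2025, Thm 1);
* has at least `N²` lines (the quadratic size–width law `ResLinSW.quadratic_le_length_of_isResLinRefutation`,
  rung 2): size at least `(|φ_N| / 8^514)²`, i.e. QUADRATIC IN THE FORMULA SIZE with no logarithmic
  loss — compare Bhattacharya–Byramji–Chattopadhyay–Impagliazzo STOC 2026 Thm 1.2, `D log S = Ω(n²)`
  hence `S = Ω(n²/log n)` for lifted Tseitin formulas ("the first superlinear size lower bound with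
  respect to formula size for general Res(⊕)", p. 2), whose real content is the exponential bound at
  depth `≤ n^{2-ε}`, far beyond anything here;
* if tree-like (every line used as a premise at most once), has at least `2^(2N - 1542)` lines (the
  tree-like law `ResLinSW.pow_le_length_of_treeLike`, rung 3b; tree-like Res(⊕) bounds for lifted
  formulas are in print: Itsykson–Sokolov 2020 §5, Part–Tzameret 2021 via size–width).
Everything is a COROLLARY of landed files; the only new ingredient of this generation is the expander.
The constants are those of the crude expander (`514 = 2·256 + 2`, `1542 = 3·514`, `2^18`).

NOT claimed: any superquadratic dag-like bound (the crux; idea-bound), any bounded-depth statement,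
novelty of the mathematics.
-/

namespace Summit.PneNP.PneNP.Theorems

-- `Summit.PneNP.PneNP` repeats a path component by design (summit = sub-problem); silence the linter.
set_option linter.dupNamespace false

open Finset Literature.Computability.Complexity Literature.Computability.MetaComplexity

/-- **An unconditional hard family for Res(⊕).** For every `N ≥ 2^18` there is a connected graph
`G` on `Fin N` of maximum degree `≤ 514` such that the lifted Tseitin contradiction
`φ = tseitinMaj G c₀` (`c₀` charges vertex `0` only) is an unsatisfiable CNF of width `≤ 1542` with
variable indices `< 3N²` and at most `N · 8^514` clauses, and every Res(⊕) refutation `π` of `φ`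
has `resLinWidth π > 2N`, at least `N²` lines, and — if tree-like — at least `2^(2N - 1542)` lines.
[folklore] -/
theorem exists_liftedTseitin_resLin_hard (N : ℕ) (hN : 2 ^ 18 ≤ N) :
    ∃ (G : SimpleGraph (Fin N)) (_ : DecidableRel G.Adj), G.Connected ∧ (∀ v, G.degree v ≤ 514) ∧
      (tseitinMaj G (fun u => decide (u.val = 0))).IsWidthLE 1542 ∧
      (tseitinMaj G (fun u => decide (u.val = 0))).numVars ≤ 3 * N ^ 2 ∧
      (tseitinMaj G (fun u => decide (u.val = 0))).length ≤ N * 8 ^ 514 ∧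
      ¬ (tseitinMaj G (fun u => decide (u.val = 0))).Satisfiable ∧
      ∀ π : List ResLinLine, IsResLinRefutation (tseitinMaj G (fun u => decide (u.val = 0))) π →
        2 * N < resLinWidth π ∧ N ^ 2 ≤ π.length ∧
        ((∀ i : ℕ, (π.map fun l => l.premises.count i).sum ≤ 1) → 2 ^ (2 * N - 1542) ≤ π.length) := by
  obtain ⟨G, inst, hconn, hdeg, hexp⟩ := exists_medium_edgeExpander N hN
  refine ⟨G, inst, hconn, hdeg, ?_⟩
  -- parameters and unsatisfiability (route supports, landed)
  have hpar := @tseitinMajParams_proof N 514 G inst (fun u => decide (u.val = 0)) hdeg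
  have hodd : Odd (Finset.univ.filter fun u : Fin N => (decide (u.val = 0)) = true).card := by
    have hcard : (Finset.univ.filter fun u : Fin N => (decide (u.val = 0)) = true).card = 1 := by
      rw [Finset.card_eq_one]
      refine ⟨⟨0, by omega⟩, ?_⟩
      ext u
      simp [Fin.ext_iff]
    rw [hcard]
    exact odd_one
  have hunsat := @tseitinMajUnsat_proof N G inst (fun u => decide (u.val = 0)) hodd
  -- rank: every medium set has more than `2N - 1` boundary edges
  have hexp' : ∀ U : Finset (Fin N), (N + 7) / 8 < U.card → U.card + (N + 7) / 8 < N →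
      2 * N - 1 < (edgeCut G U).card := by
    intro U h1 h2
    have := hexp U h1 h2
    omega
  have hwidth : ∀ π, IsResLinRefutation (tseitinMaj G (fun u => decide (u.val = 0))) π →
      2 * N + 1 ≤ resLinWidth π := by
    intro π hπ
    have h := ResLinBoundaryLaw.lt_resLinWidth_of_connected G (fun u => decide (u.val = 0))
      (by omega) hconn hodd (2 * N - 1) hexp' π hπ
    omega
  refine ⟨hpar.1, hpar.2.1, hpar.2.2, hunsat, fun π hπ => ⟨?_, ?_, ?_⟩⟩
  · have := hwidth π hπ
    omega
  · -- quadratic law with `k = 2N + 1`, `t = 1542`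
    have h := ResLinSW.quadratic_le_length_of_isResLinRefutation (t := 1542) (k := 2 * N + 1)
      hpar.1 hwidth (by omega) hπ
    have h1 : 2 * N + 1 - 1 = 2 * N := by omega
    rw [h1] at h
    nlinarith
  · -- tree-like law with `k = 2N + 1`, `t = 1542`
    intro htree
    have h := ResLinSW.pow_le_length_of_treeLike (t := 1542) (k := 2 * N + 1) hpar.1 hwidth hπ htree
    have h1 : 2 * N + 1 - 1542 - 1 = 2 * N - 1542 := by omega
    rwa [h1] at h

end Summit.PneNP.PneNP.Theorems
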